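import Summits.HodgeConjecture.HodgeConjecture.Theorems.Ring2WeilCoverageNormCriteria
import Summits.HodgeConjecture.HodgeConjecture.Theorems.Ring2WeilNormObstructionDescentCensus
import HarnessLib

/-!
# Weil-type family coverage — Schur-index-one curve families on the NON-SPLIT target rows R2 and R3 (ring2-b02, gen 59)

research route conditional on HC_CM; not a corollary; Q11.4-sentence-2 already refuted in dim ≥ 3.

Ring 2, WEIL-TYPE FAMILY-COVERAGE CENSUS (`HOME/WEIL-FAMILY-COVERAGE.md` `## b02 (g = 6)`, block b02.19 P.S. 3, owner
ring2-b02).  Companion to `Ring2WeilCoverageTetrahedralPrymsNonsplit` (row R1).  Two further Schur-index-ONE windows of the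
census engine `smono.py` (THEOREM R of b02.19: the `(χ+χ̄)`-isotypic piece of a `G`-curve is `B^d`, `B = e₁₁P`):
* `G₄₈ = 2T ∘ C₄` (central product of the binary tetrahedral group with `C₄`, order 48) with `χ = ρ₂ ⊗ μ`
  (`ρ₂` the quaternionic representation of `2T`, `μ` faithful on `C₄`): `K = ℚ(i)`, `d = 2`, realised by
  `i_ℍ ↦ [[i,0],[0,−i]]`, `j_ℍ ↦ [[0,1],[−1,0]]`; an element of order 3 has `det(1 − χ) = (1−ω)(1−ω²) = 3`, INERT in
  `ℚ(i)` — the factors with an odd number of order-3 branch points land on `(3, ℚ(i), [−3])` = row W6.1.3 (R3).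
* `G₆₀ = F₂₀ × C₃` with `χ = ψ₄ ⊗ λ` (`ψ₄` the rational 4-dimensional constituent of the permutation representation of
  `F₂₀ = C₅ ⋊ C₄` on `𝔽₅`, `λ` faithful on `C₃`): `K = ℚ(√-3)`, `d = 4`; an element of order 5 has `det(1 − χ) = Φ₅(1) = 5`
  and the invariant hermitian form has `det h_W = 5` — the prime 5 (inert in `ℚ(√-3)`) enters and some factors land on
  `(3, ℚ(√-3), [−5])` = row W6.3.5 (R2).
THIS FILE pins the arithmetic half of those placements: the literal `det H` computed by the engine (exact rationals;
Morita-reduced Fox/fatgraph model, van Geemen's `H = S + θE`; cross-checked on R3 by the independent polygon `H¹` model)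
lies in the class `[−3]` resp. `[−5]`, which is NOT the split class (`negThree_ne_split_three_one`,
`negFive_ne_split_three_three` of `Ring2WeilNormObstructionDescentCensus`: descent at the inert primes 3 resp. 5).
The signature `(3,3)` (three routes: fatgraph, polygon, holomorphic Chevalley–Weil from characters) and the monodromy
statements are the census's computations, not kernel facts.

No `def`, no named fact, no `sorry`; nothing here is a statement about Hodge classes; `HC_CM` is used nowhere.

References: [cite: vanGeemen1994HodgeAV, 5.2 and (5.4.1)].
-/

noncomputable section

set_option linter.dupNamespace false

open Literature.AlgebraicGeometry.Motives
open Literature.AlgebraicGeometry.VanGeemen1994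
open Summit.HodgeConjecture.HodgeConjecture.Ring2.Hypotheses
open Summit.HodgeConjecture.Ring2WeilNormDescent

namespace Summit.HodgeConjecture.HodgeConjecture.Ring2.WeilCoverage

/-- **the `ρ₂⊗μ`-factor `B_t = e₁₁P_t` (`dim 6`) of the `G₄₈ = 2T∘C₄`-covers of `ℙ¹` of type `(0; −1, −1·c, 3A, 4, 6B·c)` (orders 2,4,3,4,12; genus 39; all 12 admissible tuples in ONE braid orbit; 2-parameter family): `ℚ(i)`-signature `(3,3)`, literal `det H = −1/995328 = −1/(2¹²·3⁵)`; `(−1/995328)⁻¹·(−3) = 2985984 = 1728²` is a norm from `ℚ(i)`, so the class is `[−3]` — the NON-split row `W6.1.3 = (3, ℚ(i), a ≡ 3)` (TARGET R3); monodromy Zariski-dense in `SU(3,3)` (35/35).**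
research route conditional on HC_CM; not a corollary; Q11.4-sentence-2 already refuted in dim ≥ 3. [cite: vanGeemen1994HodgeAV, (5.4.1)] -/
theorem g48_m1_m1c_3A_4_6Bc_mk_detH_eq :
    (QuotientGroup.mk (Units.mk0 ((-1 : ℚ) / 995328) (by norm_num)) : weilNormResidueGroup 1) =
      QuotientGroup.mk (Units.mk0 (-3 : ℚ) (by norm_num)) := by
  rw [QuotientGroup.eq]
  have e : (Units.mk0 ((-1 : ℚ) / 995328) (by norm_num))⁻¹ * Units.mk0 (-3 : ℚ) (by norm_num) =
      Units.mk0 (2985984 : ℚ) (by norm_num) := Units.ext (by norm_num)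
  rw [e]
  exact mem_normUnitsSubgroup_of_sq_add_mul_sq _ (1728 : ℚ) (0 : ℚ) (by norm_num)

/-- … hence NOT the split class: the factor lies on the non-split row (no hyperbolic member).
research route conditional on HC_CM; not a corollary; Q11.4-sentence-2 already refuted in dim ≥ 3. [cite: vanGeemen1994HodgeAV, (5.4.1)] -/
theorem g48_m1_m1c_3A_4_6Bc_mk_detH_ne_split :
    (QuotientGroup.mk (Units.mk0 ((-1 : ℚ) / 995328) (by norm_num)) : weilNormResidueGroup 1) ≠
      splitDiscriminantClass 3 1 := by
  rw [g48_m1_m1c_3A_4_6Bc_mk_detH_eq]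
  exact negThree_ne_split_three_one

/-- **the `ρ₂⊗μ`-factor over `(0; −1, −1·c, 3A, 6A, 6A·c)` (12 tuples, one orbit): `(3,3)`, `det H = −1/1990656 = −1/(2¹³·3⁵)`; `(−1/1990656)⁻¹·(−3) = 5971968 = 1728² + 1728²`, class `[−3]` = row `W6.1.3` (R3).**
research route conditional on HC_CM; not a corollary; Q11.4-sentence-2 already refuted in dim ≥ 3. [cite: vanGeemen1994HodgeAV, (5.4.1)] -/
theorem g48_m1_m1c_3A_6A_6Ac_mk_detH_eq :
    (QuotientGroup.mk (Units.mk0 ((-1 : ℚ) / 1990656) (by norm_num)) : weilNormResidueGroup 1) =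
      QuotientGroup.mk (Units.mk0 (-3 : ℚ) (by norm_num)) := by
  rw [QuotientGroup.eq]
  have e : (Units.mk0 ((-1 : ℚ) / 1990656) (by norm_num))⁻¹ * Units.mk0 (-3 : ℚ) (by norm_num) =
      Units.mk0 (5971968 : ℚ) (by norm_num) := Units.ext (by norm_num)
  rw [e]
  exact mem_normUnitsSubgroup_of_sq_add_mul_sq _ (1728 : ℚ) (1728 : ℚ) (by norm_num)

/-- … hence NOT the split class: the factor lies on the non-split row (no hyperbolic member).
research route conditional on HC_CM; not a corollary; Q11.4-sentence-2 already refuted in dim ≥ 3. [cite: vanGeemen1994HodgeAV, (5.4.1)] -/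
theorem g48_m1_m1c_3A_6A_6Ac_mk_detH_ne_split :
    (QuotientGroup.mk (Units.mk0 ((-1 : ℚ) / 1990656) (by norm_num)) : weilNormResidueGroup 1) ≠
      splitDiscriminantClass 3 1 := by
  rw [g48_m1_m1c_3A_6A_6Ac_mk_detH_eq]
  exact negThree_ne_split_three_one

/-- **the `ρ₂⊗μ`-factor over `(0; −1, 3A, 3A·c, 6B, 6B·c)` (36 tuples, one orbit; 2 parameters): `(3,3)`, `det H = −1/3981312 = −1/(2¹⁴·3⁵)`; `(−1/3981312)⁻¹·(−3) = 11943936 = 3456²`, class `[−3]` = row `W6.1.3` (R3); `SU(3,3)` dense (35/35).**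
research route conditional on HC_CM; not a corollary; Q11.4-sentence-2 already refuted in dim ≥ 3. [cite: vanGeemen1994HodgeAV, (5.4.1)] -/
theorem g48_m1_3A_3Ac_6B_6Bc_mk_detH_eq :
    (QuotientGroup.mk (Units.mk0 ((-1 : ℚ) / 3981312) (by norm_num)) : weilNormResidueGroup 1) =
      QuotientGroup.mk (Units.mk0 (-3 : ℚ) (by norm_num)) := by
  rw [QuotientGroup.eq]
  have e : (Units.mk0 ((-1 : ℚ) / 3981312) (by norm_num))⁻¹ * Units.mk0 (-3 : ℚ) (by norm_num) =
      Units.mk0 (11943936 : ℚ) (by norm_num) := Units.ext (by norm_num)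
  rw [e]
  exact mem_normUnitsSubgroup_of_sq_add_mul_sq _ (3456 : ℚ) (0 : ℚ) (by norm_num)

/-- … hence NOT the split class: the factor lies on the non-split row (no hyperbolic member).
research route conditional on HC_CM; not a corollary; Q11.4-sentence-2 already refuted in dim ≥ 3. [cite: vanGeemen1994HodgeAV, (5.4.1)] -/
theorem g48_m1_3A_3Ac_6B_6Bc_mk_detH_ne_split :
    (QuotientGroup.mk (Units.mk0 ((-1 : ℚ) / 3981312) (by norm_num)) : weilNormResidueGroup 1) ≠
      splitDiscriminantClass 3 1 := by
  rw [g48_m1_3A_3Ac_6B_6Bc_mk_detH_eq]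
  exact negThree_ne_split_three_one

/-- **the `ψ₄⊗λ`-factor `B_t = e₁₁P_t` (`dim 6`; `P = B⁴`) of the `G₆₀ = F₂₀ × C₃`-covers of `ℙ¹` of type `(0; 2, 4a·ω, 4a·ω, 5·ω)` (orders 2,12,12,15; 100 admissible tuples, one orbit; 1-parameter family): `ℚ(√-3)`-signature `(3,3)`, literal `det H = −4096/2109375 = −2¹²/(3³·5⁷)`; `(−4096/2109375)⁻¹·(−5) = 10546875/4096 = 0² + 3·(1875/64)²` is a norm from `ℚ(√-3)`, so the class is `[−5]` — the NON-split row `W6.3.5 = (3, ℚ(√-3), a ≡ 5)` (TARGET R2); commutant of the monodromy `= K` (density not certified by the unipotent route: this datum has no unipotent braid generators).**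
research route conditional on HC_CM; not a corollary; Q11.4-sentence-2 already refuted in dim ≥ 3. [cite: vanGeemen1994HodgeAV, (5.4.1)] -/
theorem g60_2_4aw_4aw_5w_mk_detH_eq :
    (QuotientGroup.mk (Units.mk0 ((-4096 : ℚ) / 2109375) (by norm_num)) : weilNormResidueGroup 3) =
      QuotientGroup.mk (Units.mk0 (-5 : ℚ) (by norm_num)) := by
  rw [QuotientGroup.eq]
  have e : (Units.mk0 ((-4096 : ℚ) / 2109375) (by norm_num))⁻¹ * Units.mk0 (-5 : ℚ) (by norm_num) =
      Units.mk0 ((10546875 : ℚ) / 4096) (by norm_num) := Units.ext (by norm_num)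
  rw [e]
  exact mem_normUnitsSubgroup_of_sq_add_mul_sq _ (0 : ℚ) ((1875 : ℚ) / 64) (by norm_num)

/-- … hence NOT the split class: the factor lies on the non-split row (no hyperbolic member).
research route conditional on HC_CM; not a corollary; Q11.4-sentence-2 already refuted in dim ≥ 3. [cite: vanGeemen1994HodgeAV, (5.4.1)] -/
theorem g60_2_4aw_4aw_5w_mk_detH_ne_split :
    (QuotientGroup.mk (Units.mk0 ((-4096 : ℚ) / 2109375) (by norm_num)) : weilNormResidueGroup 3) ≠
      splitDiscriminantClass 3 3 := by
  rw [g60_2_4aw_4aw_5w_mk_detH_eq]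
  exact negFive_ne_split_three_three

/-- **the `ψ₄⊗λ`-factor over `(0; 2, 2·ω, 4a·ω, 4b·ω)` (120 tuples, one orbit; 1 parameter): `(3,3)`, `det H = −4096/2109375`, class `[−5]` = row `W6.3.5` (R2).**
research route conditional on HC_CM; not a corollary; Q11.4-sentence-2 already refuted in dim ≥ 3. [cite: vanGeemen1994HodgeAV, (5.4.1)] -/
theorem g60_2_2w_4aw_4bw_mk_detH_eq :
    (QuotientGroup.mk (Units.mk0 ((-4096 : ℚ) / 2109375) (by norm_num)) : weilNormResidueGroup 3) =
      QuotientGroup.mk (Units.mk0 (-5 : ℚ) (by norm_num)) := by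
  rw [QuotientGroup.eq]
  have e : (Units.mk0 ((-4096 : ℚ) / 2109375) (by norm_num))⁻¹ * Units.mk0 (-5 : ℚ) (by norm_num) =
      Units.mk0 ((10546875 : ℚ) / 4096) (by norm_num) := Units.ext (by norm_num)
  rw [e]
  exact mem_normUnitsSubgroup_of_sq_add_mul_sq _ (0 : ℚ) ((1875 : ℚ) / 64) (by norm_num)

/-- … hence NOT the split class: the factor lies on the non-split row (no hyperbolic member).
research route conditional on HC_CM; not a corollary; Q11.4-sentence-2 already refuted in dim ≥ 3. [cite: vanGeemen1994HodgeAV, (5.4.1)] -/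
theorem g60_2_2w_4aw_4bw_mk_detH_ne_split :
    (QuotientGroup.mk (Units.mk0 ((-4096 : ℚ) / 2109375) (by norm_num)) : weilNormResidueGroup 3) ≠
      splitDiscriminantClass 3 3 := by
  rw [g60_2_2w_4aw_4bw_mk_detH_eq]
  exact negFive_ne_split_three_three

end Summit.HodgeConjecture.HodgeConjecture.Ring2.WeilCoverage

end
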